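import Mathlib
import Summits.Ventures.PercRepro2.Defs
import Summits.Ventures.PercRepro2.Graph
import Summits.Ventures.PercRepro2.OneColourSwitch
import Summits.Ventures.PercRepro2.RegionHubSign
import Summits.Ventures.PercRepro2.SideSwitch
import Summits.Ventures.PercRepro2.SideSwitchFibre
import Summits.Ventures.PercRepro2.SideSwitchClosed
import Summits.Ventures.PercRepro2.SideSwitchComps
import Summits.Ventures.PercRepro2.M9NoPocketDefs
import Summits.Ventures.PercRepro2.M9NoPocketWorld
import Summits.Ventures.PercRepro2.M9NoPocketFibre
import Summits.Ventures.PercRepro2.M9NoPocketCompl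
import Summits.Ventures.PercRepro2.M9RegionSplit
import Summits.Ventures.PercRepro2.M9PocketCubeDefs
import Summits.Ventures.PercRepro2.M9PocketCubeFibre
import Summits.Ventures.PercRepro2.M9PocketCubeCompl
import Summits.Ventures.PercRepro2.M9PocketCubeHub
import Summits.Ventures.PercRepro2.M9PocketCubeWorldMono
import Summits.Ventures.PercRepro2.M9DeadEnd
import Summits.Ventures.PercRepro2.M9DeadEndMono
import Summits.Ventures.PercRepro2.M9DeadEndHarris
import Summits.Ventures.PercRepro2.M9LinkedHubCube
import Summits.Ventures.PercRepro2.M9LinkedGroup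
import Summits.Ventures.PercRepro2.M9LinkedGroupClosed
import Summits.Ventures.PercRepro2.M9LinkedGroupLegal
import Summits.Ventures.PercRepro2.M9LinkedGroupAnti
import Summits.Ventures.PercRepro2.M9HarrisCube
import Summits.Ventures.PercRepro2.M9PocketCubeMono
import Summits.Ventures.PercRepro2.M9GeneralDSplit
import Summits.Ventures.PercRepro2.M9GeneralDHD
import Summits.Ventures.PercRepro2.M9LinkedHD

/-!
# The group complement and the transfer `yInd (κ_Z y) ≤ yInd (cdualP y)` (blind cell PercRepro2,
p3 g29, 2026-08-28; steps (iv)–(v) of the `Y`-pocket-group plan, part 1)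

The **group complement** `κ_Z y = (hi.1 ∖ y.1, lo.2 ∪ (hi.2 ∖ y.2))` of the interval `[lo, hi]` of a
cube vector `x` (`M9LinkedGroup`) maps the interval to itself, is an involution on it and is
antitone.  **Transfer** (`conn_endsD_compl_of_groupDual`): a `Y`-connection `p ~ q` of `G − d` at
`κ_Z y` is a `W`-connection of `G − d` at `y` — inside the `Y`-cluster of `p` at `κ_Z y` (which
avoids the `Y`-pocket of `x` and the `Y`-world of `G − d`) every open edge is a pocket edge outside
`E_Z`, flipped between `y` and `κ_Z y`, or an edge of a free block switched at exactly one of the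
two (`conn_endsD_of_le_within_cluster`).  Hence `σ̃_pq y ≤ yInd y − yInd (κ_Z y)` on the group
interval of a `Sep`, `K`-side point (`sigma_endsD_le_sub_groupDual`).  Part 2
(`M9LinkedGroupTilt2`) runs the tilt.  Own work; std axioms.
-/

namespace Summit.Ventures.PercRepro2

namespace NoPocket

open Finset Classical RegionHub OneColourSwitch SideSwitch TermSwitch

variable {V : Type*} {E : Type*}

section Tilt

variable [Fintype V] [DecidableEq V] [Fintype E] [DecidableEq E]

variable (ends : E → Sym2 V)

/-- **The group complement** of the interval of `x`. -/
noncomputable def groupDual (d r s : V) (ρ : Config E) (x y : Finset (Finset V) × Finset E) :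
    Finset (Finset V) × Finset E :=
  ((groupHi ends d r s ρ x).1 \ y.1,
    (groupLo ends d r s ρ x).2 ∪ ((groupHi ends d r s ρ x).2 \ y.2))

/-- The `K`-side `HD ∧ r ~_Y s` region of the interval of `x`. -/
noncomputable def groupRegion (p q r s d : V) (ρ : Config E) (x : Finset (Finset V) × Finset E) :
    Finset (Finset (Finset V) × Finset E) :=
  (groupInterval ends d r s ρ x).filter (fun y => HD ends p q r s d (assignX ends y ρ) ∧
    d ∈ K2 ends r s (assignX ends y ρ) ∧ Conn ends (assignX ends y ρ) r s)

variable {ends}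

/-- Membership in the region. -/
lemma mem_groupRegion {p q r s d : V} {ρ : Config E} {x y : Finset (Finset V) × Finset E} :
    y ∈ groupRegion ends p q r s d ρ x ↔ y ∈ groupInterval ends d r s ρ x ∧
      (HD ends p q r s d (assignX ends y ρ) ∧ d ∈ K2 ends r s (assignX ends y ρ) ∧
        Conn ends (assignX ends y ρ) r s) := by
  simp [groupRegion]

/-- The lower corner lies below the upper corner. -/
lemma groupLo_le_groupHi {d r s : V} {ρ : Config E} (x : Finset (Finset V) × Finset E) :
    groupLo ends d r s ρ x ≤ groupHi ends d r s ρ x :=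
  ⟨Finset.empty_subset _, Finset.subset_union_left⟩

/-- The group complement maps the interval to itself. -/
lemma groupDual_mem_groupInterval {d r s : V} {ρ : Config E}
    {x y : Finset (Finset V) × Finset E} (h : y ∈ groupInterval ends d r s ρ x) :
    groupDual ends d r s ρ x y ∈ groupInterval ends d r s ρ x := by
  obtain ⟨hy, hlo, hhi⟩ := mem_groupInterval.1 h
  obtain ⟨hT, hF⟩ := mem_cubeP.1 hy
  refine mem_groupInterval.2 ⟨?_, ⟨Finset.empty_subset _, Finset.subset_union_left⟩,
    Finset.sdiff_subset, ?_⟩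
  · refine mem_cubeP.2 ⟨?_, ?_⟩
    · exact Finset.sdiff_subset.trans Finset.sdiff_subset
    · intro e he
      rcases Finset.mem_union.1 he with h1 | h1
      · exact mem_freeE.2 (Or.inr (Finset.mem_filter.1 (Finset.mem_inter.1 h1).2).1)
      · rcases Finset.mem_union.1 (Finset.mem_sdiff.1 h1).1 with h2 | h2
        · exact mem_freeE.2 (Or.inr (Finset.mem_filter.1 (Finset.mem_inter.1 h2).2).1)
        · exact mem_freeE.2 (Or.inr (Finset.mem_sdiff.1 h2).1)
  · intro e he
    rcases Finset.mem_union.1 he with h1 | h1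
    · exact Finset.mem_union.2 (Or.inl h1)
    · exact (Finset.mem_sdiff.1 h1).1

/-- The group complement is an involution on the interval. -/
lemma groupDual_groupDual {d r s : V} {ρ : Config E} {x y : Finset (Finset V) × Finset E}
    (h : y ∈ groupInterval ends d r s ρ x) :
    groupDual ends d r s ρ x (groupDual ends d r s ρ x y) = y := by
  obtain ⟨_, hlo, hhi⟩ := mem_groupInterval.1 h
  have h1 : y.1 ⊆ (groupHi ends d r s ρ x).1 := hhi.1
  have h2 : y.2 ⊆ (groupHi ends d r s ρ x).2 := hhi.2
  have h3 : (groupLo ends d r s ρ x).2 ⊆ y.2 := hlo.2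
  simp only [groupDual]
  ext1
  · simp only
    rw [Finset.sdiff_sdiff_eq_self h1]
  · simp only
    ext e
    constructor
    · intro he
      rcases Finset.mem_union.1 he with h4 | h4
      · exact h3 h4
      · obtain ⟨h5, h6⟩ := Finset.mem_sdiff.1 h4
        by_contra h7
        exact h6 (Finset.mem_union.2 (Or.inr (Finset.mem_sdiff.2 ⟨h5, h7⟩)))
    · intro he
      by_cases hl : e ∈ (groupLo ends d r s ρ x).2
      · exact Finset.mem_union.2 (Or.inl hl)
      · refine Finset.mem_union.2 (Or.inr (Finset.mem_sdiff.2 ⟨h2 he, ?_⟩))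
        intro h4
        rcases Finset.mem_union.1 h4 with h5 | h5
        · exact hl h5
        · exact (Finset.mem_sdiff.1 h5).2 he

/-- The group complement is antitone. -/
lemma groupDual_antitone {d r s : V} {ρ : Config E} {x y y' : Finset (Finset V) × Finset E}
    (hyy' : y ≤ y') : groupDual ends d r s ρ x y' ≤ groupDual ends d r s ρ x y :=
  ⟨Finset.sdiff_subset_sdiff le_rfl hyy'.1,
    Finset.union_subset_union le_rfl (Finset.sdiff_subset_sdiff le_rfl hyy'.2)⟩

omit [Fintype V] in
/-- `p` is outside the `Y`-pocket of a `Sep`, `K`-side point. -/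
lemma p_notMem_pocketY {p q r s d : V} {ρ : Config E} {x : Finset (Finset V) × Finset E}
    (hsepx : sep2 ends p q r s (assignX ends x ρ)) (hKx : d ∈ K2 ends r s (assignX ends x ρ)) :
    p ∉ pocketY ends d r s ρ x := by
  intro hp
  apply (not_mem_K2_of_sep2 hsepx).1
  rcases mem_K2_iff.1 hKx with h1 | h1
  · exact mem_K2_iff.2 (Or.inl (conn_trans h1 (conn_d_of_mem_pocketY hp)))
  · exact mem_K2_iff.2 (Or.inr (conn_trans h1 (conn_d_of_mem_pocketY hp)))

/-- **Transfer**: a `Y`-connection `p ~ q` of `G − d` at the group complement of `y` is a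
`W`-connection of `G − d` at `y`. -/
theorem conn_endsD_compl_of_groupDual {p q r s d : V} (hr : d ≠ r) (hs : d ≠ s) {ρ : Config E}
    (hρ : ρ ∈ RepP ends p q r s d)
    {x y : Finset (Finset V) × Finset E} (hx : x ∈ cubeP ends d r s ρ)
    (hsepx : sep2 ends p q r s (assignX ends x ρ)) (hKx : d ∈ K2 ends r s (assignX ends x ρ))
    (hy : y ∈ groupInterval ends d r s ρ x)
    (hc : Conn (endsD ends d) (assignX ends (groupDual ends d r s ρ x y) ρ) p q) :
    Conn (endsD ends d) (OneColourSwitch.compl (assignX ends y ρ)) p q := by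
  obtain ⟨hρD, hρP⟩ := mem_RepP.1 hρ
  have hy' := groupDual_mem_groupInterval (ends := ends) hy
  obtain ⟨hT, hF⟩ := mem_cubeP.1 (mem_cubeP_of_mem_groupInterval hy)
  obtain ⟨hT', hF'⟩ := mem_cubeP.1 (mem_cubeP_of_mem_groupInterval hy')
  have hsepD' := sep2_endsD_assignX' hr hs hρD hT' hF'
  have hpK := (not_mem_K2_of_sep2 hsepD').1
  have hpP := p_notMem_pocketY hsepx hKx
  refine conn_endsD_of_le_within_cluster ?_ hc
  intro e a b hends hab had hbd hpa hpb he
  have haK := not_mem_K2_endsD_of_conn hpK hpa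
  have hbK := not_mem_K2_endsD_of_conn hpK hpb
  have haP : a ∉ pocketY ends d r s ρ x :=
    fun haP => hpP (mem_pocketY_of_conn_endsD hr hs hρ hx hy' haP (conn_symm hpa))
  have hbP : b ∉ pocketY ends d r s ρ x :=
    fun hbP => hpP (mem_pocketY_of_conn_endsD hr hs hρ hx hy' hbP (conn_symm hpb))
  simp only [OneColourSwitch.compl]
  rw [Bool.not_eq_true']
  rcases edge_trichotomy hr hs hρD e with h1 | ⟨C, hC, z, hz, w, hzw⟩ | h1
  · -- inside `{r, s}`: `a` would lie in the `Y`-world of `G − d`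
    exfalso
    obtain ⟨y₁, hy₁, z₁, hz₁, hyz⟩ := h1
    rw [hends, Sym2.eq_iff] at hyz
    have ha' : a ∈ ({r, s} : Set V) := by
      rcases hyz with ⟨h2, _⟩ | ⟨h2, _⟩
      · rw [h2]
        exact hy₁
      · rw [h2]
        exact hz₁
    apply haK
    rcases ha' with h3 | h3 <;> rw [h3]
    · exact mem_K2_iff.2 (Or.inl (conn_refl _ _ _))
    · exact mem_K2_iff.2 (Or.inr (conn_refl _ _ _))
  · -- a block edge: the block is switched at the complement, unswitched at `y`
    have hzK : z ∈ K2 (endsD ends d) r s ρ := mem_K2_endsD_of_mem_block hρD hC hz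
    -- `z ∈ {a, b}` is outside the `Y`-world at the complement, so `C` is switched there
    have hzK' : z ∉ K2 (endsD ends d) r s (assignX ends (groupDual ends d r s ρ x y) ρ) := by
      rw [hends, Sym2.eq_iff] at hzw
      rcases hzw with ⟨h2, _⟩ | ⟨_, h2⟩
      · rw [← h2]
        exact haK
      · rw [← h2]
        exact hbK
    rw [K2_endsD_assignX' hr hs hρD hT' hF'] at hzK'
    have hCd : C ∈ (groupDual ends d r s ρ x y).1 := by
      by_contra hCd
      exact hzK' ⟨hzK, fun hzT => by
        obtain ⟨C', hC', hzC'⟩ := mem_unionT.1 (Finset.mem_coe.1 hzT)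
        exact hCd (block_eq_of_mem hC (hT' hC') hz hzC' ▸ hC')⟩
    have hCy : C ∉ y.1 := (Finset.mem_sdiff.1 hCd).2
    rw [assignX_touch_block hρD hT' hF' hr hs hC hz hzw, if_pos hCd] at he
    rw [assignX_touch_block hρD hT hF hr hs hC hz hzw, if_neg hCy]
    rw [Bool.not_eq_true'] at he
    exact he
  · rcases mem_freeE.1 h1 with hTe | hPe
    · -- a `T`-edge is at `d`
      exfalso
      rcases mem_Tset.1 hTe with h2 | h2 <;> rw [hends, Sym2.eq_iff] at h2
      · rcases h2 with ⟨h3, _⟩ | ⟨_, h3⟩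
        · exact had h3
        · exact hbd h3
      · rcases h2 with ⟨h3, _⟩ | ⟨_, h3⟩
        · exact had h3
        · exact hbd h3
    · -- a pocket edge outside `E_Z`: flipped at the complement iff not at `y`
      have heZ : e ∉ EZ ends d r s ρ x := by
        intro heZ
        obtain ⟨v, hv, w', hvw⟩ := (Finset.mem_filter.1 heZ).2
        rw [hends, Sym2.eq_iff] at hvw
        rcases hvw with ⟨h2, _⟩ | ⟨_, h2⟩
        · exact haP (h2 ▸ hv)
        · exact hbP (h2 ▸ hv)
      have hρe : ρ e = false := hρP e hPe
      rw [assignX_Pk hρD hT' hPe] at he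
      rw [assignX_Pk hρD hT hPe]
      by_cases hed : e ∈ (groupDual ends d r s ρ x y).2
      · have hey : e ∉ y.2 := by
          simp only [groupDual] at hed
          rcases Finset.mem_union.1 hed with h2 | h2
          · exact absurd (Finset.mem_inter.1 h2).2 heZ
          · exact (Finset.mem_sdiff.1 h2).2
        rw [if_neg hey]
        exact hρe
      · rw [if_neg hed, hρe] at he
        exact absurd he (by decide)

/-- `σ̃_pq y ≤ yInd y − yInd (κ_Z y)` on the group interval of a `Sep`, `K`-side point. -/
theorem sigma_endsD_le_sub_groupDual {p q r s d : V} (hr : d ≠ r) (hs : d ≠ s) {ρ : Config E}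
    (hρ : ρ ∈ RepP ends p q r s d)
    {x y : Finset (Finset V) × Finset E} (hx : x ∈ cubeP ends d r s ρ)
    (hsepx : sep2 ends p q r s (assignX ends x ρ)) (hKx : d ∈ K2 ends r s (assignX ends x ρ))
    (hy : y ∈ groupInterval ends d r s ρ x) :
    sigma (endsD ends d) (assignX ends y ρ) p q ≤
      yInd ends p q d ρ y - yInd ends p q d ρ (groupDual ends d r s ρ x y) := by
  obtain ⟨hρD, _⟩ := mem_RepP.1 hρ
  rw [sigma_endsD_eq_sub_cdualP hr hs hρD (mem_cubeP_of_mem_groupInterval hy)]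
  have key : yInd ends p q d ρ (groupDual ends d r s ρ x y) ≤
      yInd ends p q d ρ (cdualP ends d r s ρ y) := by
    simp only [yInd]
    split_ifs with h1 h2
    · exact le_rfl
    · exfalso
      apply h2
      rw [conn_endsD_cdualP_iff hr hs hρD (mem_cubeP_of_mem_groupInterval hy)]
      exact conn_endsD_compl_of_groupDual hr hs hρ hx hsepx hKx hy h1
    · norm_num
    · exact le_rfl
  linarith


end Tilt

end NoPocket

end Summit.Ventures.PercRepro2
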